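import Summits.Ventures.Crystal3D.Theorems.StickyWulffConstantGenericWallFloorStepGain
import HarnessLib

/-!
# The slot frame identity `Σ_w ⟪A w, x⟫² = 4 ‖x‖²` and the three far slots of a twin cap

HONEST FRAMING. Part of the venture `Summits/Ventures/Crystal3D` (cell `crystal3d-full`), helper for the
crux `GenericWallFloor` (stmt-Ventures-19480) of `route-Ventures-StickyWulffConstant`, REGISTERED line
`WallLedgerG` (planner cf-p1 gen 16), stub `stub_twoSlabAdhesion : TwoSlabAdhesion` (THE CRUX of the line).
Vector bookkeeping for the twin caps of the general-filling ledger (`exit_twinCap_of_patch` classifies the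
twelve slots by `⟪A w, n⟫ ∈ {0, ±√(2/3)}`): the twelve slots form a tight frame, so exactly THREE of them lie
on the far side of the layer plane — the far triple whose mirror images are the cappers (`exists_capper_rise`
needs three distinct far slots).  Rung credit only; F-C1 not moved.

* `sum_slots_inner_sq` — `Σ_{w ∈ fccSlots} ⟪w, x⟫² = 4 ‖x‖²` (explicit twelve-term computation);
* `card_far_slots_eq_three` — if `⟪A w, n⟫ ∈ {0, ±√(2/3)}` for all slots (`n` unit), then exactly three
  slots have `⟪A w, n⟫ > 0`; `exists_three_far_slots` — hence three distinct far slots.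

WHAT THIS IS NOT: vector algebra; F-C1 not moved.
-/

noncomputable section

namespace Summit.Ventures.Crystal3D.Theorems

open Summit.Ventures.Crystal3D Finset
open Literature.MathematicalPhysics.StatisticalMechanics (barlowPos fccStacking constHagg haggLabel_const
  barlowPos_apply_zero barlowPos_apply_one barlowPos_apply_two)
open Literature.Algebra.EuclideanLattices (inner_fin_three)
open scoped InnerProductSpace

/-- **Tight frame**: `Σ_{w ∈ fccSlots} ⟪w, x⟫² = 4 ‖x‖²`. -/
theorem sum_slots_inner_sq (x : EuclideanSpace ℝ (Fin 3)) :
    ∑ w ∈ fccSlots, ⟪w, x⟫_ℝ ^ 2 = 4 * ‖x‖ ^ 2 := by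
  classical
  have hinj : Set.InjOn (fun c : ℤ × ℤ × ℤ => barlowPos 1 (Real.sqrt (2 / 3)) constHagg c.1 c.2.1 c.2.2)
      ↑fccSlotTriples := by
    intro c _ c' _ h
    have := barlowPos_fcc_injective h
    simp only [Prod.mk.injEq] at this
    exact Prod.ext this.1 (Prod.ext this.2.1 this.2.2)
  rw [fccSlots, Finset.sum_image hinj]
  have h3 : Real.sqrt 3 ^ 2 = 3 := Real.sq_sqrt (by norm_num)
  have h23 : Real.sqrt (2 / 3) ^ 2 = 2 / 3 := Real.sq_sqrt (by norm_num)
  have hn : ‖x‖ ^ 2 = x 0 ^ 2 + x 1 ^ 2 + x 2 ^ 2 := norm_sq_eq_fin3 x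
  have hinner : ∀ k i j : ℤ, ⟪barlowPos 1 (Real.sqrt (2 / 3)) constHagg k i j, x⟫_ℝ =
      (1 * ((i : ℝ) + (j : ℝ) / 2 + (k : ℝ) / 2)) * x 0 +
        (1 * Real.sqrt 3 / 2 * ((j : ℝ) + (k : ℝ) / 3)) * x 1 + ((k : ℝ) * Real.sqrt (2 / 3)) * x 2 := by
    intro k i j
    rw [inner_fin_three, barlowPos_apply_zero, barlowPos_apply_one, barlowPos_apply_two, haggLabel_const]
  rw [hn]
  simp only [fccSlotTriples, hinner]
  norm_num
  have h2 : Real.sqrt 2 ^ 2 = 2 := Real.sq_sqrt (by norm_num)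
  have hs3 : Real.sqrt 3 ≠ 0 := by positivity
  field_simp
  linear_combination (48 * Real.sqrt 3 ^ 2 * x 1 ^ 2 - 144 * x 2 ^ 2) * h3 + (216 * x 2 ^ 2) * h2

/-- Moved frame version: `Σ_{w ∈ fccSlots} ⟪A w, x⟫² = 4 ‖x‖²`. -/
theorem sum_slots_inner_sq_frame (A : EuclideanSpace ℝ (Fin 3) ≃ₗᵢ[ℝ] EuclideanSpace ℝ (Fin 3))
    (x : EuclideanSpace ℝ (Fin 3)) : ∑ w ∈ fccSlots, ⟪A w, x⟫_ℝ ^ 2 = 4 * ‖x‖ ^ 2 := by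
  have h := sum_slots_inner_sq (A.symm x)
  rw [LinearIsometryEquiv.norm_map] at h
  rw [← h]
  refine Finset.sum_congr rfl fun w _ => ?_
  rw [← LinearIsometryEquiv.inner_map_map A w (A.symm x), LinearIsometryEquiv.apply_symm_apply]

/-- **Exactly three far slots.**  If `n` is a unit vector with `⟪A w, n⟫ ∈ {0, ±√(2/3)}` for all twelve
slots `w`, then exactly three slots have `⟪A w, n⟫ > 0`. -/
theorem card_far_slots_eq_three (A : EuclideanSpace ℝ (Fin 3) ≃ₗᵢ[ℝ] EuclideanSpace ℝ (Fin 3))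
    {n : EuclideanSpace ℝ (Fin 3)} (hn : ‖n‖ = 1)
    (hcls : ∀ w ∈ fccSlots, ⟪A w, n⟫_ℝ = 0 ∨ ⟪A w, n⟫_ℝ = Real.sqrt (2 / 3) ∨ ⟪A w, n⟫_ℝ = -Real.sqrt (2 / 3)) :
    (fccSlots.filter fun w => 0 < ⟪A w, n⟫_ℝ).card = 3 := by
  classical
  have h23 : Real.sqrt (2 / 3) ^ 2 = 2 / 3 := Real.sq_sqrt (by norm_num)
  have hrpos : 0 < Real.sqrt (2 / 3) := by positivity
  -- the sum of squares counts the nonzero slots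
  have hsq : ∀ w ∈ fccSlots, ⟪A w, n⟫_ℝ ^ 2 = if ⟪A w, n⟫_ℝ = 0 then 0 else 2 / 3 := by
    intro w hw
    rcases hcls w hw with h | h | h
    · rw [if_pos h, h]; ring
    · rw [if_neg (by rw [h]; exact hrpos.ne'), h, h23]
    · rw [if_neg (by rw [h]; exact (neg_ne_zero.2 hrpos.ne')), h, neg_sq, h23]
  have hsum := sum_slots_inner_sq_frame A n
  rw [hn, one_pow, mul_one, Finset.sum_congr rfl hsq, Finset.sum_ite, Finset.sum_const_zero, zero_add,
    Finset.sum_const, nsmul_eq_mul] at hsum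
  have hnz : (fccSlots.filter fun w => ¬ ⟪A w, n⟫_ℝ = 0).card = 6 := by
    have : ((fccSlots.filter fun w => ¬ ⟪A w, n⟫_ℝ = 0).card : ℝ) = 6 := by linarith
    exact_mod_cast this
  -- nonzero = positive ∪ negative, and negation swaps the two
  have hsplit := Finset.card_filter_add_card_filter_not (s := fccSlots.filter fun w => ¬ ⟪A w, n⟫_ℝ = 0)
    (fun w => 0 < ⟪A w, n⟫_ℝ)
  rw [Finset.filter_filter, Finset.filter_filter, hnz] at hsplit
  have hP : (fccSlots.filter fun w => ¬ ⟪A w, n⟫_ℝ = 0 ∧ 0 < ⟪A w, n⟫_ℝ) =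
      fccSlots.filter fun w => 0 < ⟪A w, n⟫_ℝ := by
    ext w; simp only [mem_filter]
    constructor
    · rintro ⟨hw, -, h⟩; exact ⟨hw, h⟩
    · rintro ⟨hw, h⟩; exact ⟨hw, h.ne', h⟩
  have hN : (fccSlots.filter fun w => ¬ ⟪A w, n⟫_ℝ = 0 ∧ ¬ 0 < ⟪A w, n⟫_ℝ) =
      fccSlots.filter fun w => ⟪A w, n⟫_ℝ < 0 := by
    ext w; simp only [mem_filter]
    constructor
    · rintro ⟨hw, h1, h2⟩; exact ⟨hw, lt_of_le_of_ne (not_lt.1 h2) h1⟩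
    · rintro ⟨hw, h⟩; exact ⟨hw, h.ne, not_lt.2 h.le⟩
  rw [hP, hN] at hsplit
  have hbij : (fccSlots.filter fun w => ⟪A w, n⟫_ℝ < 0).card = (fccSlots.filter fun w => 0 < ⟪A w, n⟫_ℝ).card := by
    refine Finset.card_nbij' (fun w => -w) (fun w => -w) ?_ ?_ (fun w _ => neg_neg w) (fun w _ => neg_neg w)
    · intro w hw
      rw [Finset.mem_coe, mem_filter] at hw ⊢
      refine ⟨neg_mem_fccSlots hw.1, ?_⟩
      rw [map_neg, inner_neg_left]; linarith [hw.2]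
    · intro w hw
      rw [Finset.mem_coe, mem_filter] at hw ⊢
      refine ⟨neg_mem_fccSlots hw.1, ?_⟩
      rw [map_neg, inner_neg_left]; linarith [hw.2]
  omega

/-- **Three distinct far slots.** -/
theorem exists_three_far_slots (A : EuclideanSpace ℝ (Fin 3) ≃ₗᵢ[ℝ] EuclideanSpace ℝ (Fin 3))
    {n : EuclideanSpace ℝ (Fin 3)} (hn : ‖n‖ = 1)
    (hcls : ∀ w ∈ fccSlots, ⟪A w, n⟫_ℝ = 0 ∨ ⟪A w, n⟫_ℝ = Real.sqrt (2 / 3) ∨ ⟪A w, n⟫_ℝ = -Real.sqrt (2 / 3)) :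
    ∃ w₁ ∈ fccSlots, ∃ w₂ ∈ fccSlots, ∃ w₃ ∈ fccSlots, w₁ ≠ w₂ ∧ w₁ ≠ w₃ ∧ w₂ ≠ w₃ ∧
      ⟪A w₁, n⟫_ℝ = Real.sqrt (2 / 3) ∧ ⟪A w₂, n⟫_ℝ = Real.sqrt (2 / 3) ∧ ⟪A w₃, n⟫_ℝ = Real.sqrt (2 / 3) := by
  classical
  have hrpos : 0 < Real.sqrt (2 / 3) := by positivity
  obtain ⟨w₁, w₂, w₃, h12, h13, h23, heq⟩ := Finset.card_eq_three.1 (card_far_slots_eq_three A hn hcls)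
  have far : ∀ w, w ∈ (fccSlots.filter fun w => 0 < ⟪A w, n⟫_ℝ) → w ∈ fccSlots ∧ ⟪A w, n⟫_ℝ = Real.sqrt (2 / 3) := by
    intro w hw
    rw [mem_filter] at hw
    refine ⟨hw.1, ?_⟩
    rcases hcls w hw.1 with h | h | h
    · rw [h] at hw; exact absurd hw.2 (lt_irrefl 0)
    · exact h
    · rw [h] at hw; linarith [hw.2]
  obtain ⟨m1, e1⟩ := far w₁ (by rw [heq]; simp)
  obtain ⟨m2, e2⟩ := far w₂ (by rw [heq]; simp)
  obtain ⟨m3, e3⟩ := far w₃ (by rw [heq]; simp)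
  exact ⟨w₁, m1, w₂, m2, w₃, m3, h12, h13, h23, e1, e2, e3⟩

end Summit.Ventures.Crystal3D.Theorems

end
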